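import Literature.NumberTheory.EllipticCurves.TwoIsogenyTorsor
import Literature.NumberTheory.EllipticCurves.H1UnramifiedFinite
import Literature.NumberTheory.EllipticCurves.TwoIsogenySelmerGroupRankProofs
import Literature.NumberTheory.EllipticCurves.TwoDescentLocalPadic
import Mathlib.NumberTheory.Padics.HeightOneSpectrum
import Mathlib.NumberTheory.NumberField.Completion.InfinitePlace
import Mathlib.NumberTheory.NumberField.InfinitePlace.TotallyRealComplex
import Mathlib.GroupTheory.QuotientGroup.Finite
import Mathlib.GroupTheory.Index
import HarnessLib

/-!
# The Selmer groups of the descent via `2`-isogeny and `Ш`: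
# `#S(a, b) = #α(E_{a,b}(ℚ)) · #Ш[φ]` and `2^{s + s'} = 2^{r + 2} · #Ш(E')[φ̂] · #Ш(E)[φ]`
# (Silverman, *AEC*, Thm. X.4.2(a) and Prop. X.4.9, over `ℚ`)

Sibling proof file of `TwoIsogenySelmerGroup.lean` (the explicit Selmer sets `S(a, b)`, `S'(a, b)` of
`E = E_{a,b} : y² = x³ + ax² + bx` and the named fact `cassels_selmerCorank_two_parity`) and of
`TwoIsogenyTorsor.lean` (the torsor classes `ξ_d ∈ H¹(K, E)`, `Ξ : K*/K*² → H¹(K, E)`, and the exactness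
`ker Ξ = α(E'(K))`). Everything here is proved; there are no definitions and no named facts.

Silverman's Theorem X.4.2(a) attaches to an isogeny `φ : E → E'` over a number field the exact sequence

  `0 → E'(K)/φ(E(K)) → S^{(φ)}(E/K) → Ш(E/K)[φ] → 0`,   `S^{(φ)} = {ξ ∈ H¹(K, E[φ]) : res_v ξ ↦ 0 ∈ WC(E/K_v) ∀ v}`,

and Proposition X.4.9 makes it explicit for the `2`-isogeny with kernel `{O, T}` of a curve in two-torsion
normal form: `H¹(K, E[φ]) = K*/K*²`, the connecting map is `α`, and `S^{(φ)}` is cut out by the local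
solubility of the quartics `d u⁴ + a u²z² + (b/d) z⁴ = w²`. This file proves, for `a, b ∈ ℤ` with
`b(a² - 4b) ≠ 0`, any `V/ℚ` in two-torsion normal form with `V' = V.twoIsogenyCodomain = E_{a,b}`
(`φ : V → E_{a,b}`), and `Ξ = V.twoIsogenyTorsorHom`:

* `WeierstrassCurve.twoIsogenyTorsorClass_mem_localRestrictionKer_iff(_sqClass)` — **naturality / the
  local conditions** over any field of characteristic `0`: `res (ξ_d) = 0` in `H¹(E, V)` for a `K`-field
  `E` iff `ξ_{d_E} = 0` for the base-changed curve iff `[d]_E ∈ α(V'(E))` (the restricted cocycle *is* the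
  torsor cocycle of `V_E`; `TwoIsogenyTorsor.galAut_resGal_geomSqrt_iff`: `χ_d ∘ res = χ_{d_E}`).
* `even_padicValuation_of_twoTorsionNF`, `even_padicValRat_of_xSqClass_eq` — over `ℚ_p` with `p ∤ b`,
  `v_p(x)` is even on `E_{a,b}(ℚ_p) ∖ {O, T}` and the classes of `α(E_{a,b}(ℚ_p))` have even valuation
  (Silverman–Tate Prop. 3.8(c), `p`-adically; the strict ultrametric inequality is the tree's
  `TwoDescentLocal.valuation_add_eq_left_of_lt`).
* `sqClass_ratCast_mem_range_xSqClass_of_ringHom` — the local condition `[q] ∈ α(E_{a,b}(F))` is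
  transported along ring homomorphisms (used for `ℚ_v ≃ ℚ_p`, Mathlib's
  `Rat.HeightOneSpectrum.adicCompletion.padicEquiv`, and `ℚ_∞ ≃ ℝ`,
  `InfinitePlace.Completion.ringEquivRealOfIsReal`).
* `twoIsogenyTorsorHom_sqClass_mem_sha_iff` — **`Ξ[q] ∈ Ш(V/ℚ)` iff `[q] ∈ α(E_{a,b}(ℝ))` and
  `[q] ∈ α(E_{a,b}(ℚ_p))` for all `p`** (the tree's `Ш` is cut out by all completions of `ℚ`).
* `card_twoIsogenySelmerGroup_eq_natCard_comap` — **`S(a, b) ≅ Ξ⁻¹(Ш(V/ℚ))`** via `d ↦ [d]`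
  (injective: squarefree integers are determined by their square class; surjective: a class with the
  local conditions has even valuation at all `p ∤ b`, so is `[d]` with `d` a squarefree divisor of `b`,
  `exists_squarefree_dvd_eq_mul_sq`, and the local conditions are those of `S(a, b)`,
  `mem_twoIsogenySelmerGroup_iff_sqClass`).
* `natCard_comap_eq_natCard_ker_mul` (`#f⁻¹(S) = #ker f · #(S ∩ im f)`), `natCard_ker_twoIsogenyTorsorHom`
  (`#ker Ξ = #α(V'(K))`, from `twoIsogenyTorsorClass_eq_zero_iff`).
* **`two_pow_twoIsogenySelmerRank_eq_natCard_mul`** — `2^{dim S(a,b)} = #α(E_{a,b}(ℚ)) · #(Ш(V/ℚ) ∩ im Ξ)`: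
  Theorem X.4.2(a) for `φ : V → E_{a,b}`, counted (`Ш(V/ℚ) ∩ im Ξ = Ш(V/ℚ)[φ]`, the classes of the
  homogeneous spaces `C_d`).
* `two_pow_twoIsogenySelmerRank_eq_natCard_mul_halfModel` (`V = V₀ : y² = x³ - (a/2)x² + ((a²-4b)/16)x`,
  the model of `E'` with `V₀' = E_{a,b}` literally; `isElliptic_halfModel`),
  `two_pow_twoIsogenySelmerRank'_eq_natCard_mul` (`V = E_{a,b}`, `V' = E_{-2a, a²-4b}`), and the product
  with `#α(Γ)·#ᾱ(Γ̄) = 2^{r+2}` (`natCard_range_xSqClass_mul`, `TwoIsogenyDescentIndex.lean`):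
  **`two_pow_twoIsogenySelmerRank_add_eq`**:
  `2^{dim S + dim S'} = 2^{rank E(ℚ) + 2} · #(Ш(V₀/ℚ) ∩ im Ξ) · #(Ш(E/ℚ) ∩ im Ξ)`.
  This reduces `cassels_selmerCorank_two_parity` (`dim S + dim S' ≡ s₂(E)`) to the parity statement
  `#Ш(E')[φ̂] · #Ш(E)[φ] ≡ 2^{s₂(E) - rank E(ℚ)}`, i.e. to the Cassels–Tate pairing on `Ш(E/ℚ)[2^∞]`
  (not in this file).

## References

* J. H. Silverman, *The Arithmetic of Elliptic Curves*, 2nd ed., GTM 106 (2009), Thm. X.4.2(a) and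
  Prop. X.4.9 (with Remark X.4.7: the Selmer group is finite and effectively computable from the local
  conditions at `v ∣ 2bΔ∞`; here all places are used, as in the definition). [SilvermanAEC2009]
* J. H. Silverman, J. T. Tate, *Rational Points on Elliptic Curves*, 2nd ed. (2015), §3.5 Prop. 3.8(c)
  (`α(Γ) ⊆ {± ∏ pᵢ^{εᵢ} : pᵢ ∣ b}`), §3.6 (`2^r = #α(Γ)·#ᾱ(Γ̄)/4`). [SilvermanTate2015]
* T. Dokchitser, V. Dokchitser, Root numbers and parity of ranks of elliptic curves, J. reine angew.
  Math. 658 (2011), Thm. 30 / Cor. 33 (the use of these counts in Cassels' formula).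
  [DokchitserDokchitser2011Crelle]

## Design

Theorems only. The local statements are proved for a general base field `K` of characteristic `0` and a
`K`-field `E` in the language of `Sha.lean` (`localPoints`, `pointsMap`, `resGal`, `localRestrictionKer`),
using that `(W.baseChange E).baseChange Ē = W.baseChange Ē` and `(W.baseChange E).geomPoints = localPoints W E`
hold definitionally and that the two `Γ_E`-actions agree pointwise (`smul_localPoints_eq`), at the level
of cocycles (`oneCocycleClass_mem_resKer_iff`). Over `ℚ`, the finite places of `𝓞 ℚ` are matched with
the primes by Mathlib's `Rat.HeightOneSpectrum.primesEquiv`/`padicEquiv`, the infinite place with `ℝ` by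
`IsTotallyReal ℚ`; `Algebra ℚ ·` instances are kept syntactically those of `Sha.lean` by introducing
`CharZero` instances only after the local statements have been specialised. Inside
`namespace Literature.…` the root namespaces are opened as `_root_.WeierstrassCurve(.Affine)`
(CONVENTIONS §2).
-/

noncomputable section

open scoped Classical

universe u

/-! ## Naturality of `ξ_d` under extension of the base field: the local conditions -/

namespace Literature.NumberTheory.EllipticCurves.TwoIsogenyTorsor

variable {K : Type u} [Field K] (E : Type u) [Field E] [Algebra K E]

/-- `closureEmb (σ|_K̄ x) = τ (closureEmb x)` for `σ|_K̄ = resGal τ`. [folklore] -/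
theorem closureEmb_galAut_resGal (τ : Field.absoluteGaloisGroup E) (x : AlgebraicClosure K) :
    closureEmb (K := K) E (galAut K (resGal (K := K) E τ) x) = galAut E τ (closureEmb (K := K) E x) :=
  apply_resGalAuxOfEmb_apply (closureEmb (K := K) E) τ x

/-- `closureEmb √d` is a square root of `d` in `Ē`. [folklore] -/
theorem closureEmb_geomSqrt_mul_self (d : K) :
    closureEmb (K := K) E (geomSqrt K d) * closureEmb (K := K) E (geomSqrt K d) =
      algebraMap E (AlgebraicClosure E) (algebraMap K E d) := by
  rw [← map_mul, geomSqrt_mul_self, AlgHom.commutes]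
  rfl

/-- **`χ_d` restricts to `χ_{d_E}`**: `τ ∈ Γ_E` fixes `√d ∈ K̄` (through `resGal : Γ_E → Γ_K` and the
chosen embedding `K̄ → Ē`) iff it fixes `√(d_E) ∈ Ē` (the two square roots of `d_E` in `Ē` are
`± closureEmb √d`). [folklore] -/
theorem galAut_resGal_geomSqrt_iff [CharZero E] {d : K} (hd : d ≠ 0) (τ : Field.absoluteGaloisGroup E) :
    galAut K (resGal (K := K) E τ) (geomSqrt K d) = geomSqrt K d ↔
      galAut E τ (geomSqrt E (algebraMap K E d)) = geomSqrt E (algebraMap K E d) := by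
  have hs : closureEmb (K := K) E (geomSqrt K d) = geomSqrt E (algebraMap K E d) ∨
      closureEmb (K := K) E (geomSqrt K d) = -geomSqrt E (algebraMap K E d) := by
    rw [← mul_self_eq_mul_self_iff, closureEmb_geomSqrt_mul_self, geomSqrt_mul_self]
  have _ := hd
  constructor
  · intro h
    have h1 := congrArg (closureEmb (K := K) E) h
    rw [closureEmb_galAut_resGal] at h1
    rcases hs with h' | h'
    · rwa [h'] at h1
    · rwa [h', map_neg, neg_inj] at h1
  · intro h
    apply (closureEmb (K := K) E).toRingHom.injective
    change closureEmb (K := K) E _ = closureEmb (K := K) E _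
    rw [closureEmb_galAut_resGal]
    rcases hs with h' | h'
    · rw [h', h]
    · rw [h', map_neg, h]

end Literature.NumberTheory.EllipticCurves.TwoIsogenyTorsor

namespace WeierstrassCurve

open Literature.NumberTheory.EllipticCurves Literature.NumberTheory.EllipticCurves.TwoIsogenyTorsor
open Literature.NumberTheory.GaloisRepresentations
open WeierstrassCurve.Affine (SqUnits sqClass sqClass_mul sqClass_sq sqClass_eq_one_iff sqClass_of_ne_zero)

section BaseExtensionPoints

variable {K : Type u} [Field K] (W : WeierstrassCurve K) (E : Type u) [Field E] [Algebra K E]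

/-- `pointsMap` acts on coordinates through `closureEmb` (definitional). [folklore] -/
theorem pointsMap_some' {x y : AlgebraicClosure K}
    (h : (W.baseChange (AlgebraicClosure K)).toAffine.Nonsingular x y)
    (h' : (W.baseChange (AlgebraicClosure E)).toAffine.Nonsingular (closureEmb (K := K) E x)
      (closureEmb (K := K) E y)) :
    pointsMap W E (show W.geomPoints from Affine.Point.some x y h) =
      (show localPoints W E from
        Affine.Point.some (closureEmb (K := K) E x) (closureEmb (K := K) E y) h') :=
  rfl

/-- The `Γ_E`-action on `E(K̄_E) = localPoints W E` is the `Γ_E`-action on the geometric points of the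
base-changed curve, `(W.baseChange E).geomPoints` (the two types agree definitionally). [folklore] -/
theorem smul_localPoints_eq (τ : Field.absoluteGaloisGroup E) (P : (W.baseChange E).geomPoints) :
    (show localPoints W E from τ • P) = τ • (show localPoints W E from P) := by
  rcases P with _ | ⟨x, y, h⟩
  · rfl
  · rfl

variable [W.IsTwoTorsionNF] [W.IsElliptic]

/-- `pointsMap T = T`: the image of `T ∈ E(K̄)` in `E(K̄_E) = E_E(Ē)` is the point `T` of the
base-changed curve `E_E = W.baseChange E`. [folklore] -/
theorem pointsMap_geomTwoTorsionPoint :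
    pointsMap W E W.geomTwoTorsionPoint =
      (show localPoints W E from (W.baseChange E).geomTwoTorsionPoint) := by
  have h' : (W.baseChange (AlgebraicClosure E)).toAffine.Nonsingular (closureEmb (K := K) E 0)
      (closureEmb (K := K) E 0) := by
    rw [map_zero]; exact nonsingular_zero_zero _
  unfold geomTwoTorsionPoint twoTorsionPoint
  rw [pointsMap_some' W E (nonsingular_zero_zero _) h']
  have h0 : closureEmb (K := K) E 0 = 0 := map_zero _
  change (Affine.Point.some (closureEmb (K := K) E 0) (closureEmb (K := K) E 0) h' :
      (W.baseChange (AlgebraicClosure E)).toAffine.Point) = Affine.Point.some 0 0 _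
  simp_rw [h0]

end BaseExtensionPoints

section BaseExtension

variable {K : Type u} [Field K] [CharZero K] (W : WeierstrassCurve K) [W.IsTwoTorsionNF] [W.IsElliptic]
variable (E : Type u) [Field E] [Algebra K E] [CharZero E]

/-- **Naturality of the torsor classes under base extension.** For a `K`-field `E` (a completion
`K_v`), the restriction of `ξ_d ∈ H¹(K, E)` to `H¹(E, E)` vanishes iff the torsor class
`ξ_{d_E} ∈ H¹(E, E_E)` of the base-changed curve `E_E` vanishes: the restricted cocycle
`τ ↦ χ_d(τ|_K̄) T` *is* the cocycle `τ ↦ χ_{d_E}(τ) T` of `E_E` (`galAut_resGal_geomSqrt_iff`,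
`pointsMap_geomTwoTorsionPoint`). Silverman, *AEC*, X.§4 (the local conditions defining `S^{(φ)}` are
the vanishing of the restrictions in `WC(E/K_v)`). [cite: SilvermanAEC2009, Thm. X.4.2(a) and Prop. X.4.9] -/
theorem twoIsogenyTorsorClass_mem_localRestrictionKer_iff {d : K} (hd : d ≠ 0) :
    W.twoIsogenyTorsorClass hd ∈ W.localRestrictionKer E ↔
      (W.baseChange E).twoIsogenyTorsorClass ((map_ne_zero (algebraMap K E)).mpr hd) = 0 := by
  rw [localRestrictionKer, twoIsogenyTorsorClass, oneCocycleClass_mem_resKer_iff, twoIsogenyTorsorClass,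
    oneCocycleClass_eq_zero_iff]
  have key : ∀ τ : Field.absoluteGaloisGroup E,
      pointsMap W E (W.twoIsogenyTorsorFun d (resGal (K := K) E τ)) =
        (show localPoints W E from (W.baseChange E).twoIsogenyTorsorFun (algebraMap K E d) τ) := by
    intro τ
    simp only [twoIsogenyTorsorFun]
    by_cases hs : galAut K (resGal (K := K) E τ) (geomSqrt K d) = geomSqrt K d
    · rw [if_pos hs, if_pos ((galAut_resGal_geomSqrt_iff (K := K) E hd τ).mp hs), map_zero]
      rfl
    · rw [if_neg hs, if_neg (fun h => hs ((galAut_resGal_geomSqrt_iff (K := K) E hd τ).mpr h)),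
        pointsMap_geomTwoTorsionPoint]
  constructor
  · rintro ⟨P, hP⟩
    refine ⟨(show (W.baseChange E).geomPoints from P), fun τ => ?_⟩
    have h1 := hP τ
    change pointsMap W E (W.twoIsogenyTorsorFun d (resGal (K := K) E τ)) = τ • P - P at h1
    rw [key τ] at h1
    change (show localPoints W E from (W.baseChange E).twoIsogenyTorsorFun (algebraMap K E d) τ) =
      (show localPoints W E from τ • (show (W.baseChange E).geomPoints from P)) - P
    rw [h1, smul_localPoints_eq]
  · rintro ⟨P, hP⟩
    refine ⟨(show localPoints W E from P), fun τ => ?_⟩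
    have h1 := hP τ
    change (W.baseChange E).twoIsogenyTorsorFun (algebraMap K E d) τ = τ • P - P at h1
    change pointsMap W E (W.twoIsogenyTorsorFun d (resGal (K := K) E τ)) =
      τ • (show localPoints W E from P) - (show localPoints W E from P)
    rw [key τ, ← smul_localPoints_eq]
    exact h1

/-- **The local condition at a `K`-field `E`**: `ξ_d` dies in `H¹(E, E)` iff `[d]_E ∈ α(E'(E))`, the
image of the `E`-points of `E' = W.twoIsogenyCodomain` in `E*/E*²` (naturality + the exactness
`twoIsogenyTorsorClass_eq_zero_iff` over `E`). These are the local conditions cutting out the Selmer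
group `S^{(φ)}(E/K) ⊆ K*/K*²` of the `2`-isogeny. [cite: SilvermanAEC2009, Thm. X.4.2(a) and Prop. X.4.9] -/
theorem twoIsogenyTorsorClass_mem_localRestrictionKer_iff_sqClass {d : K} (hd : d ≠ 0) :
    W.twoIsogenyTorsorClass hd ∈ W.localRestrictionKer E ↔
      sqClass (algebraMap K E d) ∈ Set.range (W.twoIsogenyCodomain.baseChange E).xSqClass := by
  rw [twoIsogenyTorsorClass_mem_localRestrictionKer_iff, twoIsogenyTorsorClass_eq_zero_iff,
    twoIsogenyCodomain_baseChange]

end BaseExtension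

end WeierstrassCurve



namespace Literature.NumberTheory.EllipticCurves

open _root_.WeierstrassCurve _root_.WeierstrassCurve.Affine

variable {p : ℕ} [Fact p.Prime]

/-- The strict ultrametric inequality on `ℚ_p`: if `y = 0` or `v(x) < v(y)` then `x + y ≠ 0` and
`v(x + y) = v(x)`. [folklore] -/
theorem Padic.valuation_add_eq_left' {x y : ℚ_[p]} (hx : x ≠ 0) (h : y = 0 ∨ x.valuation < y.valuation) :
    x + y ≠ 0 ∧ (x + y).valuation = x.valuation := by
  by_cases hy : y = 0
  · subst hy; exact ⟨by rwa [add_zero], by rw [add_zero]⟩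
  · exact TwoDescentLocal.valuation_add_eq_left_of_lt p hx hy (h.resolve_left hy)

/-- Valuations of non-zero integers in `ℚ_p` are `≥ 0`. [folklore] -/
theorem Padic.valuation_intCast_nonneg (n : ℤ) : 0 ≤ (n : ℚ_[p]).valuation := by
  rw [Padic.valuation_intCast]; exact_mod_cast (padicValInt p n).zero_le

/-- **`v_p(x)` is even away from `b`, `p`-adically.** For integers `a, b`, a `ℚ_p`-solution of
`y² = x³ + ax² + bx` with `x ≠ 0`, and `p ∤ b`, the valuation `v_p(x)` is even: if `v(x) < 0` then
`v(x² + ax + b) = 2v(x)` and `2v(y) = 3v(x)`; if `v(x) > 0` then `x² + ax + b` is a unit and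
`2v(y) = v(x)` (Silverman–Tate, *Rational Points*, §3.5 Prop. 3.8(c): "`x = b₁M²/e²`, `b₁ ∣ b`", read
over `ℚ_p`; the tree's `even_padicValRat_of_twoTorsionNF` is the case of `ℚ`-points).
[cite: SilvermanTate2015, §3.5 Prop. 3.8(c)] -/
theorem even_padicValuation_of_twoTorsionNF {a b : ℤ} {x y : ℚ_[p]}
    (he : y ^ 2 = x ^ 3 + a * x ^ 2 + b * x) (hx : x ≠ 0) (hpb : ¬ (p : ℤ) ∣ b) :
    Even x.valuation := by
  have hb : b ≠ 0 := fun h0 => hpb (h0 ▸ dvd_zero _)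
  have hb0 : (b : ℚ_[p]) ≠ 0 := by exact_mod_cast hb
  have hvb : (b : ℚ_[p]).valuation = 0 := by
    rw [Padic.valuation_intCast, padicValInt.eq_zero_of_not_dvd hpb]; rfl
  set v := x.valuation with hv
  -- the parity from `y² = x · q` with `v(q)` known
  have key : ∀ {q : ℚ_[p]}, q ≠ 0 → y ^ 2 = x * q → Even (v + q.valuation) := by
    intro q hq hyq
    have hy : y ≠ 0 := by
      rintro rfl
      exact mul_ne_zero hx hq (by rw [← hyq]; ring)
    have h1 := congrArg Padic.valuation hyq
    rw [Padic.valuation_pow, Padic.valuation_mul hx hq] at h1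
    refine ⟨y.valuation, ?_⟩
    rw [← hv] at h1; push_cast at h1; omega
  rcases lt_trichotomy v 0 with hneg | hzero | hpos
  · -- `v < 0`: `v(x² + (ax + b)) = 2v`
    have hx2 : (x ^ 2).valuation = 2 * v := by rw [Padic.valuation_pow]; rfl
    have hx20 : x ^ 2 ≠ 0 := pow_ne_zero 2 hx
    have hrest : (a * x + b : ℚ_[p]) = 0 ∨ (x ^ 2).valuation < (a * x + (b : ℚ_[p])).valuation := by
      by_cases h0 : (a * x + b : ℚ_[p]) = 0
      · exact Or.inl h0
      · right
        rw [hx2]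
        by_cases ha : (a : ℚ_[p]) = 0
        · rw [ha, zero_mul, zero_add, hvb]; omega
        · -- `v(ax + b) ≥ min (v(a) + v, 0) ≥ v > 2v`
          have hax0 : (a : ℚ_[p]) * x ≠ 0 := mul_ne_zero ha hx
          have h2 := Padic.le_valuation_add h0
          rw [Padic.valuation_mul ha hx, hvb] at h2
          have ha' := Padic.valuation_intCast_nonneg (p := p) a
          have : v ≤ min ((a : ℚ_[p]).valuation + x.valuation) 0 := le_min (by rw [← hv]; omega) hneg.le
          omega
    obtain ⟨hq0, hvq⟩ := Padic.valuation_add_eq_left' hx20 hrest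
    have hfac : y ^ 2 = x * (x ^ 2 + (a * x + b)) := by linear_combination he
    have hk := key hq0 hfac
    rw [hvq, hx2] at hk
    obtain ⟨k, hk⟩ := hk
    exact ⟨k - v, by omega⟩
  · exact ⟨0, by omega⟩
  · -- `v > 0`: `v(b + (x² + ax)) = 0`
    have hrest : (x ^ 2 + a * x : ℚ_[p]) = 0 ∨ (b : ℚ_[p]).valuation < (x ^ 2 + a * x : ℚ_[p]).valuation := by
      by_cases h0 : (x ^ 2 + a * x : ℚ_[p]) = 0
      · exact Or.inl h0
      · right
        rw [hvb]
        have hfx : (x ^ 2 + a * x : ℚ_[p]) = x * (x + a) := by ring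
        have hxa0 : (x + a : ℚ_[p]) ≠ 0 := fun h => h0 (by rw [hfx, h, mul_zero])
        rw [hfx, Padic.valuation_mul hx hxa0]
        -- `v(x + a) ≥ 0`
        have h3 : 0 ≤ (x + (a : ℚ_[p])).valuation := by
          by_cases ha : (a : ℚ_[p]) = 0
          · rw [ha, add_zero]; exact hpos.le
          · have h2 := Padic.le_valuation_add hxa0
            have ha' := Padic.valuation_intCast_nonneg (p := p) a
            have : 0 ≤ min x.valuation (a : ℚ_[p]).valuation := le_min (by rw [← hv]; exact hpos.le) ha'
            omega
        rw [← hv]; omega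
    obtain ⟨hq0, hvq⟩ := Padic.valuation_add_eq_left' hb0 hrest
    have hfac : y ^ 2 = x * ((b : ℚ_[p]) + (x ^ 2 + a * x)) := by linear_combination he
    have hk := key hq0 hfac
    rw [hvq, hvb, add_zero] at hk
    exact hk

/-- **Classes in `α(E(ℚ_p))` have even valuation away from `b`.** For `E = E_{a,b}` over `ℚ_p` with
`p ∤ b` and a rational `q ≠ 0` with `[q] = α(P)` for some `P ∈ E(ℚ_p)`, `v_p(q)` is even
(`α(O) = 1`, `α(T) = [b]` with `v_p(b) = 0`, `α(x, y) = [x]` with `v_p(x)` even).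
[cite: SilvermanTate2015, §3.5 Prop. 3.8(c)] -/
theorem even_padicValRat_of_xSqClass_eq {a b : ℤ} (hpb : ¬ (p : ℤ) ∣ b) {q : ℚ} (hq : q ≠ 0)
    {P : (⟨0, (a : ℚ_[p]), 0, (b : ℚ_[p]), 0⟩ : WeierstrassCurve ℚ_[p]).toAffine.Point}
    (hP : (⟨0, (a : ℚ_[p]), 0, (b : ℚ_[p]), 0⟩ : WeierstrassCurve ℚ_[p]).xSqClass P = sqClass (q : ℚ_[p])) :
    Even (padicValRat p q) := by
  have hb : b ≠ 0 := fun h0 => hpb (h0 ▸ dvd_zero _)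
  have hb0 : (b : ℚ_[p]) ≠ 0 := by exact_mod_cast hb
  have hq0 : (q : ℚ_[p]) ≠ 0 := by exact_mod_cast hq
  have hvb : (b : ℚ_[p]).valuation = 0 := by
    rw [Padic.valuation_intCast, padicValInt.eq_zero_of_not_dvd hpb]; rfl
  -- from `e · q = c²` with `v(e)` even, `v(q)` is even
  have key : ∀ {e : ℚ_[p]}, e ≠ 0 → Even e.valuation → sqClass e = sqClass (q : ℚ_[p]) →
      Even (padicValRat p q) := by
    intro e he hev h
    have h1 : sqClass (e * q) = 1 := by rw [sqClass_mul he hq0, h, Affine.SqUnits.mul_self]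
    obtain ⟨c, hc⟩ := (sqClass_eq_one_iff (mul_ne_zero he hq0)).mp h1
    have hc0 : c ≠ 0 := by rintro rfl; exact mul_ne_zero he hq0 (by rw [hc]; ring)
    have h2 := congrArg Padic.valuation hc
    rw [Padic.valuation_mul he hq0, Padic.valuation_pow, Padic.valuation_ratCast] at h2
    obtain ⟨k, hk⟩ := hev
    exact ⟨c.valuation - k, by push_cast at h2; omega⟩
  rcases P with _ | ⟨x, y, hxy⟩
  · rw [← Affine.Point.zero_def, xSqClass_zero] at hP
    have h11 : sqClass (1 : ℚ_[p]) = 1 := (sqClass_eq_one_iff one_ne_zero).mpr ⟨1, by ring⟩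
    exact key one_ne_zero ⟨0, by rw [Padic.valuation_one]; rfl⟩ (h11.trans hP)
  · by_cases hx : x = 0
    · rw [xSqClass_some_of_eq_zero hxy hx] at hP
      exact key hb0 ⟨0, by rw [hvb]; rfl⟩ hP
    · rw [xSqClass_some_of_ne_zero hxy hx] at hP
      have he : y ^ 2 = x ^ 3 + a * x ^ 2 + b * x := by
        have := hxy.1
        rw [Affine.equation_iff] at this
        simp only at this
        linear_combination this
      exact key hx (even_padicValuation_of_twoTorsionNF he hx hpb) hP

end Literature.NumberTheory.EllipticCurves


namespace Literature.NumberTheory.EllipticCurves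

open _root_.WeierstrassCurve _root_.WeierstrassCurve.Affine

/-- **Counting through a homomorphism.** For `f : A → B` and a subgroup `S ≤ B`,
`#f⁻¹(S) = #ker f · #(S ∩ f(A))` (the exact sequence `0 → ker f → f⁻¹(S) → S ∩ im f → 0`).
[folklore] -/
theorem natCard_comap_eq_natCard_ker_mul {A B : Type*} [AddCommGroup A] [AddCommGroup B]
    (f : A →+ B) (S : AddSubgroup B) :
    Nat.card (S.comap f) = Nat.card f.ker * Nat.card ↥(S ⊓ f.range) := by
  set g : S.comap f →+ B := f.comp (S.comap f).subtype with hg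
  have hrange : g.range = S ⊓ f.range := by
    ext b
    simp only [hg, AddMonoidHom.mem_range, AddMonoidHom.coe_comp, AddSubgroup.coe_subtype,
      Function.comp_apply, AddSubgroup.mem_inf]
    constructor
    · rintro ⟨⟨a, ha⟩, rfl⟩
      exact ⟨ha, a, rfl⟩
    · rintro ⟨hb, a, rfl⟩
      exact ⟨⟨a, hb⟩, rfl⟩
  have hker : g.ker = f.ker.addSubgroupOf (S.comap f) := by
    ext ⟨a, ha⟩
    simp [hg, AddMonoidHom.mem_ker, AddSubgroup.mem_addSubgroupOf]
  have hle : f.ker ≤ S.comap f := fun a ha => by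
    rw [AddMonoidHom.mem_ker] at ha
    simp [AddSubgroup.mem_comap, ha]
  have h1 := (g.ker).card_eq_card_quotient_mul_card_addSubgroup
  rw [Nat.card_congr (QuotientAddGroup.quotientKerEquivRange g).toEquiv, hrange, hker,
    Nat.card_congr (AddSubgroup.addSubgroupOfEquivOfLe hle).toEquiv] at h1
  rw [h1, mul_comm]

variable {F F' : Type*} [Field F] [Field F'] [CharZero F] [CharZero F']

/-- **Transport of the local condition along a ring homomorphism.** For integers `a, b` with
`b(a² - 4b) ≠ 0`, `q ∈ ℚ*`, and a ring homomorphism `f : F → F'` of fields of characteristic `0`: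
if `[q] ∈ α(E_{a,b}(F))` then `[q] ∈ α(E_{a,b}(F'))` (map the point). In particular the condition
is invariant under `F ≃+* F'` (e.g. `ℚ_v ≃ ℚ_p`, `ℚ_∞ ≃ ℝ`). [folklore] -/
theorem sqClass_ratCast_mem_range_xSqClass_of_ringHom (f : F →+* F') {a b : ℤ}
    (hab : b * (a ^ 2 - 4 * b) ≠ 0) {q : ℚ} (hq : q ≠ 0)
    (h : sqClass (q : F) ∈ Set.range (⟨0, (a : F), 0, (b : F), 0⟩ : WeierstrassCurve F).xSqClass) :
    sqClass (q : F') ∈ Set.range (⟨0, (a : F'), 0, (b : F'), 0⟩ : WeierstrassCurve F').xSqClass := by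
  haveI := isElliptic_mk_of_ne_zero (F := F) hab
  haveI := isElliptic_mk_of_ne_zero (F := F') hab
  have hb : b ≠ 0 := left_ne_zero_of_mul hab
  have hqF : (q : F) ≠ 0 := by exact_mod_cast hq
  have hqF' : (q : F') ≠ 0 := by exact_mod_cast hq
  have hfq : f (q : F) = (q : F') := map_ratCast f q
  -- square classes with square product agree
  have sqeq : ∀ {e : F} {e' : F'}, e ≠ 0 → e' ≠ 0 → f e = e' → sqClass e = sqClass (q : F) →
      sqClass e' = sqClass (q : F') := by
    intro e e' he he' hfe hcl
    have h1 : sqClass (e * q) = 1 := by rw [sqClass_mul he hqF, hcl, Affine.SqUnits.mul_self]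
    obtain ⟨c, hc⟩ := (sqClass_eq_one_iff (mul_ne_zero he hqF)).mp h1
    have h2 : e' * (q : F') = f c ^ 2 := by rw [← hfe, ← hfq, ← map_mul, hc, map_pow]
    have h3 : sqClass e' * sqClass (q : F') = 1 := by rw [← sqClass_mul he' hqF', h2, sqClass_sq]
    calc sqClass e' = sqClass e' * (sqClass (q : F') * sqClass (q : F')) := by
          rw [Affine.SqUnits.mul_self]; exact (Affine.SqUnits.mul_one _).symm
      _ = sqClass (q : F') := by rw [← mul_assoc, h3]; exact Affine.SqUnits.one_mul _
  obtain ⟨P, hP⟩ := h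
  rcases P with _ | ⟨x, y, hxy⟩
  · rw [← Affine.Point.zero_def, xSqClass_zero] at hP
    refine ⟨0, ?_⟩
    rw [xSqClass_zero]
    have h11 : sqClass (1 : F) = 1 := (sqClass_eq_one_iff one_ne_zero).mpr ⟨1, by ring⟩
    have h11' : sqClass (1 : F') = 1 := (sqClass_eq_one_iff one_ne_zero).mpr ⟨1, by ring⟩
    rw [← h11']
    exact sqeq one_ne_zero one_ne_zero (map_one f) (h11.trans hP)
  · by_cases hx : x = 0
    · rw [xSqClass_some_of_eq_zero hxy hx] at hP
      refine ⟨(⟨0, (a : F'), 0, (b : F'), 0⟩ : WeierstrassCurve F').twoTorsionPoint, ?_⟩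
      rw [twoTorsionPoint, xSqClass_some_of_eq_zero _ rfl]
      exact sqeq (by exact_mod_cast hb : ((b : F)) ≠ 0) (by exact_mod_cast hb : ((b : F')) ≠ 0)
        (map_intCast f b) hP
    · rw [xSqClass_some_of_ne_zero hxy hx] at hP
      have hxy' : (⟨0, (a : F'), 0, (b : F'), 0⟩ : WeierstrassCurve F').toAffine.Nonsingular (f x) (f y) := by
        have h1 := (WeierstrassCurve.Affine.map_nonsingular (⟨0, (a : F), 0, (b : F), 0⟩ : WeierstrassCurve F)
          f.injective (x := x) (y := y)).mpr hxy
        have hW : (⟨0, (a : F), 0, (b : F), 0⟩ : WeierstrassCurve F).map f = ⟨0, (a : F'), 0, (b : F'), 0⟩ := by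
          ext <;> simp [WeierstrassCurve.map]
        change ((⟨0, (a : F), 0, (b : F), 0⟩ : WeierstrassCurve F).map f).toAffine.Nonsingular (f x) (f y) at h1
        rw [hW] at h1
        exact h1
      refine ⟨.some (f x) (f y) hxy', ?_⟩
      rw [xSqClass_some_of_ne_zero hxy' ((map_ne_zero f).mpr hx)]
      exact sqeq hx ((map_ne_zero f).mpr hx) rfl hP

end Literature.NumberTheory.EllipticCurves
/-! ## The Selmer group of the `2`-isogeny as `Ξ⁻¹(Ш)` and its order -/

namespace Literature.NumberTheory.EllipticCurves

open _root_.WeierstrassCurve _root_.WeierstrassCurve.Affine IsDedekindDomain NumberField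

section ShaCount

/-- Base change of the literal curve `E_{a,b}` to a `ℚ`-algebra. [folklore] -/
theorem mk_baseChange_intCast (F : Type*) [Field F] [Algebra ℚ F] (a b : ℤ) :
    (⟨0, (a : ℚ), 0, (b : ℚ), 0⟩ : WeierstrassCurve ℚ).baseChange F = ⟨0, (a : F), 0, (b : F), 0⟩ := by
  ext <;> simp [WeierstrassCurve.baseChange, WeierstrassCurve.map]

/-- Every square class is the class of a non-zero element. [folklore] -/
theorem exists_sqClass_eq {F : Type*} [Field F] (c : SqUnits F) : ∃ q : F, q ≠ 0 ∧ sqClass q = c := by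
  obtain ⟨u, rfl⟩ := QuotientGroup.mk_surjective c
  exact ⟨u, u.ne_zero, by rw [sqClass_of_ne_zero u.ne_zero, Units.mk0_val]⟩

variable {K : Type u} [Field K] [CharZero K] (V : WeierstrassCurve K) [V.IsTwoTorsionNF] [V.IsElliptic] in
/-- **`#ker Ξ = #α(E'(K))`**: by the exactness `ker Ξ = α(E'(K))` (`twoIsogenyTorsorClass_eq_zero_iff`),
`Additive.ofMul` is a bijection `α(E'(K)) ≃ ker Ξ`. [cite: SilvermanAEC2009, Thm. X.4.2(a) and Prop. X.4.9] -/
theorem natCard_ker_twoIsogenyTorsorHom :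
    Nat.card (AddMonoidHom.ker (G := Additive (SqUnits K)) V.twoIsogenyTorsorHom) =
      Nat.card (Set.range V.twoIsogenyCodomain.xSqClass) := by
  have hmem : ∀ c : SqUnits K,
      Additive.ofMul c ∈ AddMonoidHom.ker (G := Additive (SqUnits K)) V.twoIsogenyTorsorHom ↔
      c ∈ Set.range V.twoIsogenyCodomain.xSqClass := by
    intro c
    obtain ⟨q, hq, rfl⟩ := exists_sqClass_eq c
    rw [AddMonoidHom.mem_ker, twoIsogenyTorsorHom_sqClass V hq, twoIsogenyTorsorClass_eq_zero_iff]
  symm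
  refine Nat.card_eq_of_bijective (fun c => ⟨Additive.ofMul c.1, (hmem c.1).mpr c.2⟩) ⟨?_, ?_⟩
  · intro c c' h
    exact Subtype.ext (by simpa using congrArg (fun x => Additive.toMul (Subtype.val x)) h)
  · intro x
    exact ⟨⟨Additive.toMul x.1, (hmem _).mp x.2⟩, rfl⟩

variable {a b : ℤ} (hab : b * (a ^ 2 - 4 * b) ≠ 0)
variable (V : WeierstrassCurve ℚ) [V.IsTwoTorsionNF] [V.IsElliptic]
variable (hV : V.twoIsogenyCodomain = ⟨0, (a : ℚ), 0, (b : ℚ), 0⟩)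

include hab hV in
/-- **The local conditions of `Ξ⁻¹(Ш)` are those of `S(a, b)`.** For `V/ℚ` in two-torsion normal form
with `V' = E_{a,b}` and `q ∈ ℚ*`: `Ξ[q] ∈ Ш(V/ℚ)` iff `[q] ∈ α(E_{a,b}(ℝ))` and `[q] ∈ α(E_{a,b}(ℚ_p))`
for every prime `p` — `Ш` is cut out by the completions `ℚ_v` (`v` a finite place of `𝓞 ℚ`) and
`ℚ_w` (`w` the infinite place), the local condition at a completion is `[q] ∈ α(E'(ℚ_v))`
(`twoIsogenyTorsorClass_mem_localRestrictionKer_iff_sqClass`), and it is transported along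
`ℚ_v ≃ ℚ_p` (`Rat.HeightOneSpectrum.adicCompletion.padicEquiv`) and `ℚ_w ≃ ℝ`. This identifies the
Selmer group `S^{(φ)}(V/ℚ) = {ξ : res_v ξ = 0 ∀ v}` of *AEC* X.4.2 with the explicit `S(a, b)`.
[cite: SilvermanAEC2009, Thm. X.4.2(a) and Prop. X.4.9] -/
theorem twoIsogenyTorsorHom_sqClass_mem_sha_iff {q : ℚ} (hq : q ≠ 0) :
    V.twoIsogenyTorsorHom (Additive.ofMul (sqClass q)) ∈ V.sha ↔
      (sqClass (q : ℝ) ∈ Set.range (⟨0, (a : ℝ), 0, (b : ℝ), 0⟩ : WeierstrassCurve ℝ).xSqClass ∧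
        ∀ (p : ℕ) [Fact p.Prime], sqClass (q : ℚ_[p]) ∈
          Set.range (⟨0, (a : ℚ_[p]), 0, (b : ℚ_[p]), 0⟩ : WeierstrassCurve ℚ_[p]).xSqClass) := by
  rw [twoIsogenyTorsorHom_sqClass V hq, mem_sha_iff]
  -- the local condition at a `ℚ`-field `F`
  have hloc : ∀ (F : Type) [Field F] [Algebra ℚ F], V.twoIsogenyTorsorClass hq ∈ V.localRestrictionKer F ↔
      sqClass (q : F) ∈ Set.range (⟨0, (a : F), 0, (b : F), 0⟩ : WeierstrassCurve F).xSqClass := by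
    intro F _ _
    haveI : CharZero F := charZero_of_injective_algebraMap (algebraMap ℚ F).injective
    rw [twoIsogenyTorsorClass_mem_localRestrictionKer_iff_sqClass, hV, mk_baseChange_intCast, eq_ratCast]
  constructor
  · rintro ⟨hfin, hinf⟩
    constructor
    · obtain ⟨w⟩ : Nonempty (InfinitePlace ℚ) := inferInstance
      have h1 := (hloc w.Completion).mp (hinf w)
      haveI : CharZero w.Completion := charZero_of_injective_algebraMap
        ((algebraMap ℚ w.Completion).injective)
      have e := InfinitePlace.Completion.ringEquivRealOfIsReal (IsTotallyReal.isReal w)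
      exact sqClass_ratCast_mem_range_xSqClass_of_ringHom e.toRingHom hab hq h1
    · -- every prime is `primesEquiv v` for a finite place `v` of `𝓞 ℚ`
      suffices H : ∀ p' : Nat.Primes, haveI : Fact p'.1.Prime := ⟨p'.2⟩
          sqClass (q : ℚ_[p'.1]) ∈ Set.range (⟨0, (a : ℚ_[p'.1]), 0, (b : ℚ_[p'.1]), 0⟩ : WeierstrassCurve ℚ_[p'.1]).xSqClass by
        intro p hp
        exact H ⟨p, hp.out⟩
      intro p'
      have key : ∀ (v : HeightOneSpectrum (𝓞 ℚ)) [Fact (Nat.Prime (Rat.HeightOneSpectrum.primesEquiv v).1)],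
          sqClass (q : ℚ_[(Rat.HeightOneSpectrum.primesEquiv v).1]) ∈
            Set.range (⟨0, (a : ℚ_[(Rat.HeightOneSpectrum.primesEquiv v).1]), 0,
              (b : ℚ_[(Rat.HeightOneSpectrum.primesEquiv v).1]), 0⟩ :
                WeierstrassCurve ℚ_[(Rat.HeightOneSpectrum.primesEquiv v).1]).xSqClass := by
        intro v _
        have h1 := (hloc (v.adicCompletion ℚ)).mp (hfin v)
        have f := (Rat.HeightOneSpectrum.adicCompletion.padicEquiv (R := 𝓞 ℚ) v).toRingEquiv
        haveI : CharZero (v.adicCompletion ℚ) := charZero_of_injective_algebraMap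
          ((algebraMap ℚ (v.adicCompletion ℚ)).injective)
        exact sqClass_ratCast_mem_range_xSqClass_of_ringHom f.toRingHom hab hq h1
      have h2 := @key ((Rat.HeightOneSpectrum.primesEquiv (R := 𝓞 ℚ)).symm p')
      rw [Equiv.apply_symm_apply] at h2
      exact @h2 ⟨p'.2⟩
  · rintro ⟨hreal, hpadic⟩
    constructor
    · intro v
      have goal := hloc (v.adicCompletion ℚ)
      haveI : Fact (Nat.Prime (Rat.HeightOneSpectrum.primesEquiv (R := 𝓞 ℚ) v).1) :=
        ⟨(Rat.HeightOneSpectrum.primesEquiv v).2⟩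
      have f := (Rat.HeightOneSpectrum.adicCompletion.padicEquiv (R := 𝓞 ℚ) v).toRingEquiv
      haveI : CharZero (v.adicCompletion ℚ) := charZero_of_injective_algebraMap
        ((algebraMap ℚ (v.adicCompletion ℚ)).injective)
      have h1 := hpadic (Rat.HeightOneSpectrum.primesEquiv (R := 𝓞 ℚ) v).1
      exact goal.mpr (sqClass_ratCast_mem_range_xSqClass_of_ringHom f.symm.toRingHom hab hq h1)
    · intro w
      have goal := hloc w.Completion
      haveI : CharZero w.Completion := charZero_of_injective_algebraMap
        ((algebraMap ℚ w.Completion).injective)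
      have e := InfinitePlace.Completion.ringEquivRealOfIsReal (IsTotallyReal.isReal w)
      exact goal.mpr (sqClass_ratCast_mem_range_xSqClass_of_ringHom e.symm.toRingHom hab hq hreal)

include hab hV in
/-- **`S(a, b) ≅ Ξ⁻¹(Ш(V/ℚ))`**, counted: the explicit Selmer set `S(a, b)` (squarefree divisors `d ∣ b`
whose quartic `d u⁴ + a u²z² + (b/d) z⁴ = w²` is everywhere locally soluble) is in bijection, via
`d ↦ [d]`, with the subgroup of `ℚ*/ℚ*²` of classes whose torsor class `ξ_d` lies in `Ш(V/ℚ)`: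
injective since squarefree integers are determined by their square class, surjective since a class
satisfying the local conditions has even valuation at every `p ∤ b` (`even_padicValRat_of_xSqClass_eq`)
hence is `[d]` with `d` a squarefree divisor of `b` (`exists_squarefree_dvd_eq_mul_sq`), and the local
conditions are those of `S(a, b)` (`mem_twoIsogenySelmerGroup_iff_sqClass`,
`twoIsogenyTorsorHom_sqClass_mem_sha_iff`). [cite: SilvermanAEC2009, Thm. X.4.2(a) and Prop. X.4.9] -/
theorem card_twoIsogenySelmerGroup_eq_natCard_comap :
    (twoIsogenySelmerGroup a b).card = Nat.card (V.sha.comap V.twoIsogenyTorsorHom) := by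
  have hb : b ≠ 0 := left_ne_zero_of_mul hab
  -- membership of `[d]`, `d ∈ S(a, b)`
  have hmemS : ∀ {d : ℤ}, d ∈ twoIsogenySelmerGroup a b ↔ Squarefree d ∧ d ∣ b ∧
      V.twoIsogenyTorsorHom (Additive.ofMul (sqClass ((d : ℚ)))) ∈ V.sha := by
    intro d
    rw [mem_twoIsogenySelmerGroup_iff_sqClass hab]
    refine and_congr_right fun hsq => and_congr_right fun _ => ?_
    have hd0 : (d : ℚ) ≠ 0 := by exact_mod_cast hsq.ne_zero
    rw [twoIsogenyTorsorHom_sqClass_mem_sha_iff hab V hV hd0, Rat.cast_intCast]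
    refine and_congr_right fun _ => forall_congr' fun p => forall_congr' fun _ => ?_
    rw [Rat.cast_intCast]
  rw [← Nat.card_eq_finsetCard]
  refine Nat.card_eq_of_bijective
    (fun d => ⟨Additive.ofMul (sqClass ((d.1 : ℤ) : ℚ)), (hmemS.mp d.2).2.2⟩) ⟨?_, ?_⟩
  · -- injective: squarefree integers with the same square class are equal
    rintro ⟨d₁, hd₁⟩ ⟨d₂, hd₂⟩ he
    have he' : sqClass ((d₁ : ℚ)) = sqClass ((d₂ : ℚ)) := Additive.ofMul.injective (congrArg Subtype.val he)
    have hsq₁ := squarefree_of_mem_twoIsogenySelmerGroup hd₁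
    have hsq₂ := squarefree_of_mem_twoIsogenySelmerGroup hd₂
    have h0₁ : (d₁ : ℚ) ≠ 0 := by exact_mod_cast hsq₁.ne_zero
    have h0₂ : (d₂ : ℚ) ≠ 0 := by exact_mod_cast hsq₂.ne_zero
    have h1 : sqClass ((d₁ : ℚ) * d₂) = 1 := by rw [sqClass_mul h0₁ h0₂, he', Affine.SqUnits.mul_self]
    obtain ⟨u, hu⟩ := (sqClass_eq_one_iff (mul_ne_zero h0₁ h0₂)).mp h1
    obtain ⟨m, hm⟩ : IsSquare (d₁ * d₂) := by
      rw [← Rat.isSquare_intCast_iff]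
      exact ⟨u, by push_cast; rw [hu, pow_two]⟩
    exact Subtype.ext (eq_of_squarefree_of_mul_eq_sq hsq₁ hsq₂ (m := m) (by rw [hm, pow_two]))
  · -- surjective
    rintro ⟨x, hx⟩
    obtain ⟨q, hq, hqx⟩ := exists_sqClass_eq (Additive.toMul x)
    have hx' : V.twoIsogenyTorsorHom (Additive.ofMul (sqClass q)) ∈ V.sha := by
      rw [hqx]; exact hx
    obtain ⟨hreal, hpadic⟩ := (twoIsogenyTorsorHom_sqClass_mem_sha_iff hab V hV hq).mp hx'
    have heven : ∀ p : ℕ, p.Prime → ¬ (p : ℤ) ∣ b → Even (padicValRat p q) := by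
      intro p hp hpb
      haveI : Fact p.Prime := ⟨hp⟩
      obtain ⟨P, hP⟩ := hpadic p
      exact even_padicValRat_of_xSqClass_eq hpb hq hP
    obtain ⟨d, hsq, hdvd, r, hr⟩ := exists_squarefree_dvd_eq_mul_sq hb hq heven
    have hd0 : (d : ℚ) ≠ 0 := by exact_mod_cast hsq.ne_zero
    have hr0 : r ≠ 0 := by rintro rfl; exact hq (by rw [hr]; ring)
    have hcl : sqClass q = sqClass (d : ℚ) := by
      rw [hr, sqClass_mul hd0 (pow_ne_zero 2 hr0), sqClass_sq, Affine.SqUnits.mul_one]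
    have hdS : d ∈ twoIsogenySelmerGroup a b := by
      refine hmemS.mpr ⟨hsq, hdvd, ?_⟩
      rw [← hcl]; exact hx'
    refine ⟨⟨d, hdS⟩, Subtype.ext ?_⟩
    change Additive.ofMul (sqClass ((d : ℚ))) = x
    rw [← hcl, hqx]
    rfl

include hab hV in
/-- **The order of the Selmer group of the `2`-isogeny** (Silverman, *AEC*, Thm. X.4.2(a): the exact
sequence `0 → E'(ℚ)/φ(E(ℚ)) → S^{(φ)}(E/ℚ) → Ш(E/ℚ)[φ] → 0`, counted, for `φ : V → V' = E_{a,b}`):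

  `2^{dim S(a,b)} = #α(E_{a,b}(ℚ)) · #(Ш(V/ℚ) ∩ Ξ(ℚ*/ℚ*²))`,

where `α(E_{a,b}(ℚ)) = V'(ℚ)/φ(V(ℚ))` embedded in `ℚ*/ℚ*²` and `Ш(V/ℚ) ∩ im Ξ` is the subgroup of
`Ш(V/ℚ)` of classes of the homogeneous spaces `C_d` (`= Ш(V/ℚ)[φ]`, the classes killed by `φ`).
Assembly: `#S(a,b) = #Ξ⁻¹(Ш)` (`card_twoIsogenySelmerGroup_eq_natCard_comap`),
`#Ξ⁻¹(Ш) = #ker Ξ · #(Ш ∩ im Ξ)`, `ker Ξ = α(E_{a,b}(ℚ))` (`natCard_ker_twoIsogenyTorsorHom`).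
[cite: SilvermanAEC2009, Thm. X.4.2(a) and Prop. X.4.9] -/
theorem two_pow_twoIsogenySelmerRank_eq_natCard_mul :
    2 ^ twoIsogenySelmerRank a b =
      Nat.card (Set.range (⟨0, (a : ℚ), 0, (b : ℚ), 0⟩ : WeierstrassCurve ℚ).xSqClass) *
        Nat.card ↥(V.sha ⊓ V.twoIsogenyTorsorHom.range) := by
  rw [two_pow_twoIsogenySelmerRank_eq_card hab, card_twoIsogenySelmerGroup_eq_natCard_comap hab V hV,
    natCard_comap_eq_natCard_ker_mul, natCard_ker_twoIsogenyTorsorHom, hV]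

/-! ### The two instances `φ : V₀ → E_{a,b}` and `φ : E_{a,b} → E'` and the product formula -/

/-- The model `V₀ : y² = x³ - (a/2) x² + ((a² - 4b)/16) x` of `E'_{a,b}` (the curve `E' = E_{-2a, a²-4b}`
rescaled by `(x, y) ↦ (x/4, y/8)`), whose `2`-isogenous curve is *literally* `E_{a,b}`. [folklore] -/
theorem twoIsogenyCodomain_halfModel (a b : ℤ) :
    (⟨0, -(a : ℚ) / 2, 0, ((a : ℚ) ^ 2 - 4 * b) / 16, 0⟩ : WeierstrassCurve ℚ).twoIsogenyCodomain =
      ⟨0, (a : ℚ), 0, (b : ℚ), 0⟩ := by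
  ext <;> simp [twoIsogenyCodomain] <;> ring

/-- `V₀` is an elliptic curve when `b (a² - 4b) ≠ 0` (`Δ(V₀) = b (a² - 4b)² / 16`). [folklore] -/
theorem isElliptic_halfModel (hab : b * (a ^ 2 - 4 * b) ≠ 0) :
    (⟨0, -(a : ℚ) / 2, 0, ((a : ℚ) ^ 2 - 4 * b) / 16, 0⟩ : WeierstrassCurve ℚ).IsElliptic := by
  refine ⟨isUnit_iff_ne_zero.mpr ?_⟩
  rw [Δ_of_isTwoTorsionNF]
  have hb : (b : ℚ) ≠ 0 := by exact_mod_cast left_ne_zero_of_mul hab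
  have h2 : ((a : ℚ) ^ 2 - 4 * b) ≠ 0 := by exact_mod_cast right_ne_zero_of_mul hab
  have key : (16 : ℚ) * (((a : ℚ) ^ 2 - 4 * b) / 16) ^ 2 * ((-(a : ℚ) / 2) ^ 2 - 4 * (((a : ℚ) ^ 2 - 4 * b) / 16)) =
      ((a : ℚ) ^ 2 - 4 * b) ^ 2 / 16 * b := by ring
  simp only
  rw [key]
  exact mul_ne_zero (div_ne_zero (pow_ne_zero 2 h2) (by norm_num)) hb

/-- **`#S(a, b) = #α(E_{a,b}(ℚ)) · #Ш(V₀/ℚ)[Ξ]`** for the model `V₀` of `E'_{a,b}` with `V₀' = E_{a,b}`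
(`two_pow_twoIsogenySelmerRank_eq_natCard_mul` for `V = V₀`). [cite: SilvermanAEC2009, Thm. X.4.2(a) and Prop. X.4.9] -/
theorem two_pow_twoIsogenySelmerRank_eq_natCard_mul_halfModel (hab : b * (a ^ 2 - 4 * b) ≠ 0)
    [hV₀ : (⟨0, -(a : ℚ) / 2, 0, ((a : ℚ) ^ 2 - 4 * b) / 16, 0⟩ : WeierstrassCurve ℚ).IsElliptic] :
    2 ^ twoIsogenySelmerRank a b =
      Nat.card (Set.range (⟨0, (a : ℚ), 0, (b : ℚ), 0⟩ : WeierstrassCurve ℚ).xSqClass) *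
        Nat.card ↥((⟨0, -(a : ℚ) / 2, 0, ((a : ℚ) ^ 2 - 4 * b) / 16, 0⟩ : WeierstrassCurve ℚ).sha ⊓
          (⟨0, -(a : ℚ) / 2, 0, ((a : ℚ) ^ 2 - 4 * b) / 16, 0⟩ : WeierstrassCurve ℚ).twoIsogenyTorsorHom.range) :=
  two_pow_twoIsogenySelmerRank_eq_natCard_mul hab _ (twoIsogenyCodomain_halfModel a b)

/-- **`#S'(a, b) = #α'(E'(ℚ)) · #Ш(E_{a,b}/ℚ)[Ξ]`** for `φ : E_{a,b} → E' = E_{-2a, a²-4b}`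
(`two_pow_twoIsogenySelmerRank_eq_natCard_mul` for `V = E_{a,b}`, `(a, b) ↦ (-2a, a² - 4b)`).
[cite: SilvermanAEC2009, Thm. X.4.2(a) and Prop. X.4.9] -/
theorem two_pow_twoIsogenySelmerRank'_eq_natCard_mul (hab : b * (a ^ 2 - 4 * b) ≠ 0)
    [hE : (⟨0, (a : ℚ), 0, (b : ℚ), 0⟩ : WeierstrassCurve ℚ).IsElliptic] :
    2 ^ twoIsogenySelmerRank' a b =
      Nat.card (Set.range (⟨0, ((-2 * a : ℤ) : ℚ), 0, ((a ^ 2 - 4 * b : ℤ) : ℚ), 0⟩ : WeierstrassCurve ℚ).xSqClass) *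
        Nat.card ↥((⟨0, (a : ℚ), 0, (b : ℚ), 0⟩ : WeierstrassCurve ℚ).sha ⊓
          (⟨0, (a : ℚ), 0, (b : ℚ), 0⟩ : WeierstrassCurve ℚ).twoIsogenyTorsorHom.range) := by
  rw [show twoIsogenySelmerRank' a b = twoIsogenySelmerRank (-2 * a) (a ^ 2 - 4 * b) from rfl]
  exact two_pow_twoIsogenySelmerRank_eq_natCard_mul (twoIsogenyCodomain_ne_zero hab) _
    (twoIsogenyCodomain_mk_intCast a b)

/-- **Selmer, rank and `Ш` for the descent via `2`-isogeny** (Silverman, *AEC*, X.4.2(a) for `φ` and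
its dual, with Silverman–Tate's `2^r = #α(Γ) #ᾱ(Γ̄) / 4`): for `E = E_{a,b}` over `ℚ`,

  `2^{dim S(a,b) + dim S'(a,b)} = 2^{rank E(ℚ) + 2} · #Ш(V₀/ℚ)[Ξ] · #Ш(E/ℚ)[Ξ]`,

`Ш(·)[Ξ] = Ш ∩ im Ξ` the classes of the homogeneous spaces of the two isogenies (`V₀ ≅ E'`). In
particular `dim S + dim S' ≡ rank E(ℚ) (mod 2)` iff `#Ш(V₀/ℚ)[Ξ] · #Ш(E/ℚ)[Ξ]` is an even power of
`2` — the statement to which `cassels_selmerCorank_two_parity` is thereby reduced (the missing input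
being the Cassels–Tate pairing). [cite: SilvermanAEC2009, Thm. X.4.2(a) and Prop. X.4.9]
[cite: SilvermanTate2015, §3.6 (2^r = #α(Γ)·#ᾱ(Γ̄)/4)] -/
theorem two_pow_twoIsogenySelmerRank_add_eq (hab : b * (a ^ 2 - 4 * b) ≠ 0)
    [hV₀ : (⟨0, -(a : ℚ) / 2, 0, ((a : ℚ) ^ 2 - 4 * b) / 16, 0⟩ : WeierstrassCurve ℚ).IsElliptic]
    [hE : (⟨0, (a : ℚ), 0, (b : ℚ), 0⟩ : WeierstrassCurve ℚ).IsElliptic] :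
    2 ^ (twoIsogenySelmerRank a b + twoIsogenySelmerRank' a b) =
      2 ^ ((⟨0, (a : ℚ), 0, (b : ℚ), 0⟩ : WeierstrassCurve ℚ).mordellWeilRank + 2) *
        (Nat.card ↥((⟨0, -(a : ℚ) / 2, 0, ((a : ℚ) ^ 2 - 4 * b) / 16, 0⟩ : WeierstrassCurve ℚ).sha ⊓
            (⟨0, -(a : ℚ) / 2, 0, ((a : ℚ) ^ 2 - 4 * b) / 16, 0⟩ : WeierstrassCurve ℚ).twoIsogenyTorsorHom.range) *
          Nat.card ↥((⟨0, (a : ℚ), 0, (b : ℚ), 0⟩ : WeierstrassCurve ℚ).sha ⊓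
            (⟨0, (a : ℚ), 0, (b : ℚ), 0⟩ : WeierstrassCurve ℚ).twoIsogenyTorsorHom.range)) := by
  rw [pow_add, two_pow_twoIsogenySelmerRank_eq_natCard_mul_halfModel hab,
    two_pow_twoIsogenySelmerRank'_eq_natCard_mul hab,
    ← natCard_range_xSqClass_mul (⟨0, (a : ℚ), 0, (b : ℚ), 0⟩ : WeierstrassCurve ℚ),
    twoIsogenyCodomain_mk_intCast]
  ring

end ShaCount

end Literature.NumberTheory.EllipticCurves
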